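import Mathlib
import HarnessLib
import Summits.HubbardSuperconductivity.HubbardSuperconductivity.Theorems.KLProgrammeKLRegimeEngineTwoShellLatticeMass

/-!
# Route `KLProgramme` — ENGINE item stmt-HubbardSuperconductivity-20437 `KLRegimeEngineV17F2`, class-#5 STEP (X).3 `D`-rows: the `1/ρ`-WEIGHTED lattice two-shell mass with the
# SHARP layer-cake bracket `(βΛ′/π)(3 + 2Gβ/L) + 4Gβ/L` (g16's `twoShell_weighted_sum_le` has `(βΛ′/π)(10 + 2Gβ/L) + 12Gβ/L`)
# (cell gate-hubbard-kl, seat hubbard-kl-k3c2-p2 g23, technique «thermal-bar induction n ≤ nScales β + 1 with EngineBoundsAtV4S sums»; companion of …TwoShellLatticeMass)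

WHY.  Every `D`-row of the (X).3 one-call (interior `WDd/WDx_row_le_slots`, pinned `WDd/WDx_edge_row_le_slots(_sharp)`) carries the bracket of g16's layer cake,
`(βΛ′/π)·10 + …`, whose `10 = 4 + 6` is loose twice: (a) the layer `{ρ ≤ a}` was counted inside the STRICT shell `{|e_K| < 2a}` of the area package (main term ×2),
although `{|e_K| ≤ a} ⊆ {|e_K| < a + η}` for every `η > 0` gives the count at `ε₁ = a + 0` by a limit; (b) the Matsubara window count `#{i : |ω_i| ≤ a} ≤ aβ/π + 3`
(Literature `card_filter_matsubaraFreq_le`, from `|m| ≤ ⌈aβ/2π⌉`) is really `≤ aβ/π + 1` (odd integers `2m+1` in `[−aβ/π, aβ/π]`), and the `+3` is what feeds the `6`.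
With both, the per-layer count is `(aβ/π + 1)·9A(a + Gδ)X/δ²` and the dyadic sum gives `9AL²/(2π²)·X·[(βΛ′/π)(3 + 2Gβ/L) + 4Gβ/L]` (flat constant `10 ↦ 3`):
* §1 `card_fermiMatsubara_le_sharp`, `card_filter_matsubaraFreq_le_sharp` (`≤ aβ/π + 1`), `card_disc_filter_le_sharp`;
* §2 `card_twoShell_mul_sq_le_closed` — the lattice two-shell count for the CLOSED shell `|e_K| ≤ ε₁` (`0 < ε₁ < ε₂`) at `ε₁` itself (limit `η ↓ 0`);
* §3 `sum_layers_le_sharp`, `layers_closed_form_sharp`, **`twoShell_weighted_sum_le_sharp`** (same hypotheses as `twoShell_weighted_sum_le`), `…_klTS`.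
Everything is proved; no definitions; nothing asserts any stub or superconductivity.  [cite: FeldmanSalmhoferTrubowitz1998, App. B]  0 kit · 0 lit.
-/

noncomputable section

namespace Summit.HubbardSuperconductivity.HubbardSuperconductivity.Theorems.EngineV8

set_option linter.dupNamespace false -- summit = problem name (single-conjunct summit), D-0017

open Real Set Finset
open Literature.MathematicalPhysics.QuantumLattice Literature.Probability.LatticeModels
open Literature.MathematicalPhysics.QuantumLattice.FermiRG
open Summit.HubbardSuperconductivity.HubbardSuperconductivity.Theorems.KLRegimeSplit
open Summit.HubbardSuperconductivity.HubbardSuperconductivity.Theorems.KLProgrammeLegKernels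
open Summit.HubbardSuperconductivity.HubbardSuperconductivity.Theorems.DispersionFlow

/-! ## §1 The sharp Matsubara window count -/

/-- **The sharp frequency count**: a finite set of integers `m` with `|π(2m+1)/β| ≤ a` has at most `aβ/π + 1` elements (`2m+1` runs over the odd integers of
`[−aβ/π, aβ/π]`). [folklore] -/
theorem card_fermiMatsubara_le_sharp {β : ℝ} (hβ : 0 < β) {a : ℝ} (ha : 0 ≤ a) (S : Finset ℤ)
    (hS : ∀ m ∈ S, |fermiMatsubara β m| ≤ a) : (S.card : ℝ) ≤ a * β / π + 1 := by
  have hπ := Real.pi_pos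
  set x : ℝ := a * β / π with hx
  have hx0 : 0 ≤ x := by positivity
  have key : ∀ m ∈ S, (-x - 1) / 2 ≤ (m : ℝ) ∧ (m : ℝ) ≤ (x - 1) / 2 := by
    intro m hm
    have h := hS m hm
    rw [fermiMatsubara, abs_div, abs_mul, abs_of_pos hπ, abs_of_pos hβ, div_le_iff₀ hβ] at h
    have h2 : |2 * (m : ℝ) + 1| ≤ x := by
      rw [hx, le_div_iff₀ hπ]; linarith [mul_comm π |2 * (m : ℝ) + 1|]
    obtain ⟨h3, h4⟩ := abs_le.1 h2
    constructor <;> linarith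
  rcases S.eq_empty_or_nonempty with rfl | ⟨m₀, hm₀⟩
  · simp; linarith
  set lo : ℤ := ⌈(-x - 1) / 2⌉ with hlo
  set hi : ℤ := ⌊(x - 1) / 2⌋ with hhi
  have hsub : S ⊆ Finset.Icc lo hi := fun m hm =>
    Finset.mem_Icc.2 ⟨Int.ceil_le.2 (key m hm).1, Int.le_floor.2 (key m hm).2⟩
  have hcard := Finset.card_le_card hsub
  rw [Int.card_Icc] at hcard
  have hlohi : lo ≤ hi := (Finset.mem_Icc.1 (hsub hm₀)).1.trans (Finset.mem_Icc.1 (hsub hm₀)).2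
  have hnn : 0 ≤ hi + 1 - lo := by omega
  have h1 : ((S.card : ℤ) : ℝ) ≤ ((hi + 1 - lo : ℤ) : ℝ) := by
    have : (S.card : ℤ) ≤ ((hi + 1 - lo).toNat : ℤ) := by exact_mod_cast hcard
    rw [Int.toNat_of_nonneg hnn] at this
    exact_mod_cast this
  have h2 : ((hi : ℤ) : ℝ) ≤ (x - 1) / 2 := Int.floor_le _
  have h3 : (-x - 1) / 2 ≤ ((lo : ℤ) : ℝ) := Int.le_ceil _
  push_cast at h1
  have : ((S.card : ℤ) : ℝ) = (S.card : ℝ) := by norm_cast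
  linarith

/-- **Counting the kept Matsubara indices in a window, sharp**: `#{i : |ω_i| ≤ a} ≤ aβ/π + 1` (`β > 0`, `a ≥ 0`). [folklore] -/
theorem card_filter_matsubaraFreq_le_sharp {M : ℕ} {β : ℝ} (hβ : 0 < β) {a : ℝ} (ha : 0 ≤ a) (S : Finset (MatsubaraIdx M))
    (hS : ∀ i ∈ S, |matsubaraFreq β M i| ≤ a) : (S.card : ℝ) ≤ a * β / π + 1 := by
  have hinj : Set.InjOn (matsubaraInt M) S := by
    intro i _ j _ h
    simp only [matsubaraInt] at h
    exact Fin.ext (by omega)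
  rw [← card_image_of_injOn hinj]
  refine card_fermiMatsubara_le_sharp hβ ha _ fun m hm => ?_
  obtain ⟨i, hi, rfl⟩ := mem_image.1 hm
  rw [← matsubaraFreq_eq_fermiMatsubara]
  exact hS i hi

/-- **The disc count, sharp**: `#{(ω,k̃) : ω² + e_K(p_k̃)² ≤ a² ∧ Q(k̃)} ≤ (aβ/π + 1)·#{k̃ : |e_K(p_k̃)| ≤ a ∧ Q(k̃)}` (`0 < β`, `0 ≤ a`). -/
theorem card_disc_filter_le_sharp {L M : ℕ} [NeZero L] {β : ℝ} (hβ : 0 < β) (μ : ℝ) (K : TrigPolyC4v) {a : ℝ} (ha : 0 ≤ a) (Q : TorusSite 2 L → Prop)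
    [DecidablePred Q] :
    ((univ.filter fun p : FreqMomentum L M => matsubaraFreq β M p.1 ^ 2 + nambuXiCT L μ K p.2 ^ 2 ≤ a ^ 2 ∧ Q p.2).card : ℝ) ≤
      (a * β / π + 1) * ((univ.filter fun k : TorusSite 2 L => |nambuXiCT L μ K k| ≤ a ∧ Q k).card : ℝ) := by
  classical
  set F := univ.filter fun i : MatsubaraIdx M => |matsubaraFreq β M i| ≤ a with hF
  set G := univ.filter fun k : TorusSite 2 L => |nambuXiCT L μ K k| ≤ a ∧ Q k with hG
  have hsub : (univ.filter fun p : FreqMomentum L M => matsubaraFreq β M p.1 ^ 2 + nambuXiCT L μ K p.2 ^ 2 ≤ a ^ 2 ∧ Q p.2) ⊆ F ×ˢ G := by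
    intro p hp
    obtain ⟨h1, h2⟩ := (mem_filter.1 hp).2
    obtain ⟨hω, he⟩ := abs_le_of_sq_add_sq_le ha h1
    exact mem_product.2 ⟨mem_filter.2 ⟨Finset.mem_univ _, hω⟩, mem_filter.2 ⟨Finset.mem_univ _, he, h2⟩⟩
  have hFc : (F.card : ℝ) ≤ a * β / π + 1 := card_filter_matsubaraFreq_le_sharp hβ ha F fun i hi => (mem_filter.1 hi).2
  calc ((univ.filter fun p : FreqMomentum L M => matsubaraFreq β M p.1 ^ 2 + nambuXiCT L μ K p.2 ^ 2 ≤ a ^ 2 ∧ Q p.2).card : ℝ)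
      ≤ ((F ×ˢ G).card : ℝ) := by exact_mod_cast Finset.card_le_card hsub
    _ = (F.card : ℝ) * (G.card : ℝ) := by rw [card_product]; push_cast; ring
    _ ≤ (a * β / π + 1) * (G.card : ℝ) := mul_le_mul_of_nonneg_right hFc (Nat.cast_nonneg _)

/-! ## §2 The lattice two-shell count for the closed shell at `ε₁` itself -/

/-- **The lattice two-shell count for the CLOSED inner shell**: for `0 < ε₁ < ε₂`, `ε₂ + Gδ ≤ klE0`, `0 < r ≤ |p_w̃|_𝕋`,
`#{k̃ : |e_K(p_k̃)| ≤ ε₁ ∧ |e_K(p_{k̃−w̃})| ≤ ε₂}·(2π/L)² ≤ 9A(ε₁ + Gδ)((ε₂+Gδ)/r + √(ε₂+Gδ))` — `card_twoShell_mul_sq_le` at `ε₁ + η` for every small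
`η > 0`, then `η ↓ 0`. -/
theorem card_twoShell_mul_sq_le_closed {A : ℝ} {u : RenConsts → ℝ} (h : TwoShellFrameAreaAt A u) (hA : 0 ≤ A) {R : RenConsts} (hR : R.WF2)
    {U : ℝ} (hU : 0 < U) (hUu : U ≤ u R) {μ : ℝ} (hμ : μ ∈ klWindowC) {N : ℕ} {K : TrigPolyC4v} (hK : FrameOK R U N μ K)
    {L : ℕ} [NeZero L] {ε₁ ε₂ : ℝ} (hε₁ : 0 < ε₁) (h12 : ε₁ < ε₂)
    (h2 : ε₂ + (4 + 8 / 3 * R.Gfr 1 * U ^ 2) * (2 * π / L) ≤ klE0) (wt : TorusSite 2 L) {r : ℝ} (hr : 0 < r) (hrw : r ≤ klTorusNorm L wt) :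
    ((univ.filter fun k : TorusSite 2 L => |nambuXiCT L μ K k| ≤ ε₁ ∧ |nambuXiCT L μ K (k - wt)| ≤ ε₂).card : ℝ) * (2 * π / L) ^ 2 ≤
      9 * (A * (ε₁ + (4 + 8 / 3 * R.Gfr 1 * U ^ 2) * (2 * π / L)) *
        ((ε₂ + (4 + 8 / 3 * R.Gfr 1 * U ^ 2) * (2 * π / L)) / r + Real.sqrt (ε₂ + (4 + 8 / 3 * R.Gfr 1 * U ^ 2) * (2 * π / L)))) := by
  classical
  set G : ℝ := 4 + 8 / 3 * R.Gfr 1 * U ^ 2 with hG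
  set δ : ℝ := 2 * π / L with hδ
  set X : ℝ := (ε₂ + G * δ) / r + Real.sqrt (ε₂ + G * δ) with hX
  have hGfr : ∀ j, 0 ≤ R.Gfr j := hR.wf.2.2
  have hG0 : 0 ≤ G := by rw [hG]; nlinarith [hGfr 1, sq_nonneg U]
  have hε₂ : 0 < ε₂ := hε₁.trans h12
  have hX0 : 0 ≤ X := by rw [hX]; positivity
  -- the bound at `ε₁ + η` for every `0 < η ≤ ε₂ − ε₁`
  have step : ∀ η : ℝ, 0 < η → η ≤ ε₂ - ε₁ →
      ((univ.filter fun k : TorusSite 2 L => |nambuXiCT L μ K k| ≤ ε₁ ∧ |nambuXiCT L μ K (k - wt)| ≤ ε₂).card : ℝ) * δ ^ 2 ≤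
        9 * (A * (ε₁ + G * δ) * X) + 9 * (A * X) * η := by
    intro η hη hηle
    have hsub : (univ.filter fun k : TorusSite 2 L => |nambuXiCT L μ K k| ≤ ε₁ ∧ |nambuXiCT L μ K (k - wt)| ≤ ε₂) ⊆
        univ.filter fun k : TorusSite 2 L => |nambuXiCT L μ K k| < ε₁ + η ∧ |nambuXiCT L μ K (k - wt)| ≤ ε₂ := by
      intro k hk
      obtain ⟨h1, h2'⟩ := (mem_filter.1 hk).2
      exact mem_filter.2 ⟨Finset.mem_univ _, by linarith, h2'⟩
    have c := card_twoShell_mul_sq_le h hA hR hU hUu hμ hK (by linarith : 0 < ε₁ + η) (by linarith) h2 wt hr hrw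
    rw [← hG, ← hδ, ← hX] at c
    calc _ ≤ ((univ.filter fun k : TorusSite 2 L => |nambuXiCT L μ K k| < ε₁ + η ∧ |nambuXiCT L μ K (k - wt)| ≤ ε₂).card : ℝ) * δ ^ 2 :=
          mul_le_mul_of_nonneg_right (Nat.cast_le.2 (Finset.card_le_card hsub)) (by positivity)
      _ ≤ 9 * (A * (ε₁ + η + G * δ) * X) := c
      _ = 9 * (A * (ε₁ + G * δ) * X) + 9 * (A * X) * η := by ring
  -- the limit `η ↓ 0`
  refine le_of_forall_pos_le_add fun ε hε => ?_
  by_cases hAX : 9 * (A * X) = 0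
  · have := step (ε₂ - ε₁) (by linarith) le_rfl
    rw [hAX, zero_mul, add_zero] at this
    linarith
  · have hAXpos : 0 < 9 * (A * X) := lt_of_le_of_ne (by positivity) (Ne.symm hAX)
    set η : ℝ := min (ε₂ - ε₁) (ε / (9 * (A * X))) with hη
    have hη0 : 0 < η := lt_min (by linarith) (div_pos hε hAXpos)
    have h1 := step η hη0 (min_le_left _ _)
    have h2 : 9 * (A * X) * η ≤ ε := by
      have : η ≤ ε / (9 * (A * X)) := min_le_right _ _
      rw [le_div_iff₀ hAXpos] at this; linarith
    linarith

/-! ## §3 The weighted two-shell mass with the sharp bracket -/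

/-- Summing the sharp per-layer bounds (arithmetic): with `Σ Λ′/2^i ≤ 2Λ′`, `I + 1 ≤ x`, `Σ 2^i/Λ′ ≤ 2^{I+1}/Λ′ ≤ 2β/π`. -/
theorem sum_layers_le_sharp {A X δ β Λ' G x : ℝ} (hA : 0 ≤ A) (hX : 0 ≤ X) (hδ : 0 < δ) (hβ : 0 < β) (hΛ' : 0 < Λ') (hG : 0 ≤ G) (I : ℕ)
    (hI1 : (I : ℝ) + 1 ≤ x) (h2I : (2 : ℝ) ^ (I + 1) / Λ' ≤ 2 * β / π) :
    ∑ i ∈ range (I + 1), 18 * A * X / δ ^ 2 * (β / π * (Λ' / 2 ^ i) + (G * δ * β / π + 1) + G * δ * ((2 : ℝ) ^ i / Λ')) ≤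
      18 * A * X / δ ^ 2 * (β / π * (2 * Λ') + x * (G * δ * β / π + 1) + G * δ * (2 * β / π)) := by
  have hπ := Real.pi_pos
  have hgeo := dyadic_geom_sums hΛ' I
  rw [← mul_sum, sum_add_distrib, sum_add_distrib, ← mul_sum, ← mul_sum, sum_const, card_range, nsmul_eq_mul]
  push_cast
  have hc : 0 ≤ 18 * A * X / δ ^ 2 := by positivity
  refine mul_le_mul_of_nonneg_left ?_ hc
  have h1 : 0 ≤ β / π := by positivity
  have h2 : 0 ≤ G * δ * β / π + 1 := by
    have : 0 ≤ G * δ * β / π := by positivity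
    linarith
  have h3 : 0 ≤ G * δ := by positivity
  have t1 : β / π * ∑ i ∈ range (I + 1), Λ' / 2 ^ i ≤ β / π * (2 * Λ') := mul_le_mul_of_nonneg_left hgeo.1 h1
  have t2 : ((I : ℝ) + 1) * (G * δ * β / π + 1) ≤ x * (G * δ * β / π + 1) := mul_le_mul_of_nonneg_right hI1 h2
  have t3 : G * δ * ∑ i ∈ range (I + 1), (2 : ℝ) ^ i / Λ' ≤ G * δ * (2 * β / π) := mul_le_mul_of_nonneg_left (hgeo.2.trans h2I) h3
  linarith

/-- The sharp closed form (arithmetic): `x = Λ′β/π`, `δ = 2π/L`. -/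
theorem layers_closed_form_sharp {A X β Λ' G L : ℝ} (hL : 0 < L) :
    18 * A * X / (2 * π / L) ^ 2 * (β / π * (2 * Λ') + Λ' * β / π * (G * (2 * π / L) * β / π + 1) + G * (2 * π / L) * (2 * β / π)) =
      9 * A * L ^ 2 / (2 * π ^ 2) * X * (β * Λ' / π * (3 + 2 * G * β / L) + 4 * G * β / L) := by
  have hπ := Real.pi_pos.ne'
  field_simp
  ring

/-- **THE WEIGHTED LATTICE TWO-SHELL MASS, SHARP BRACKET.**  For a two-shell area package `TwoShellFrameAreaAt A u` (`0 ≤ A`), `R.WF2`, `0 < U ≤ u R`, `μ ∈ klWindowC`,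
`FrameOK R U N μ K`, `0 < β`, a disc radius `0 < Λ′` with `2Λ′ ≤ ε₂`, `ε₂ + G·2π/L ≤ klE0` (`G = 4 + (8/3)·Gfr₁·U²`), and a lattice transfer `w̃` with
`0 < r ≤ |p_w̃|_𝕋`:
`Σ_{(ω,k̃) : ω² + e_K(p_k̃)² ≤ Λ′², |e_K(p_{k̃−w̃})| ≤ ε₂} (ω² + e_K(p_k̃)²)^{-1/2} ≤ (9AL²/(2π²))·((ε₂+Gδ)/r + √(ε₂+Gδ))·[(βΛ′/π)(3 + 2Gβ/L) + 4Gβ/L]`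
(`δ = 2π/L`; β-uniform: no `log β`). [cite: FeldmanSalmhoferTrubowitz1998, App. B] -/
theorem twoShell_weighted_sum_le_sharp {A : ℝ} {u : RenConsts → ℝ} (h : TwoShellFrameAreaAt A u) (hA : 0 ≤ A) {R : RenConsts} (hR : R.WF2)
    {U : ℝ} (hU : 0 < U) (hUu : U ≤ u R) {μ : ℝ} (hμ : μ ∈ klWindowC) {N : ℕ} {K : TrigPolyC4v} (hK : FrameOK R U N μ K)
    {L M : ℕ} [NeZero L] [NeZero M] {β : ℝ} (hβ : 0 < β) {Λ' ε₂ : ℝ} (hΛ' : 0 < Λ') (h2Λ : 2 * Λ' ≤ ε₂)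
    (h2 : ε₂ + (4 + 8 / 3 * R.Gfr 1 * U ^ 2) * (2 * π / L) ≤ klE0) (wt : TorusSite 2 L) {r : ℝ} (hr : 0 < r) (hrw : r ≤ klTorusNorm L wt) :
    ∑ p ∈ univ.filter (fun p : FreqMomentum L M => matsubaraFreq β M p.1 ^ 2 + nambuXiCT L μ K p.2 ^ 2 ≤ Λ' ^ 2 ∧ |nambuXiCT L μ K (p.2 - wt)| ≤ ε₂),
        (Real.sqrt (matsubaraFreq β M p.1 ^ 2 + nambuXiCT L μ K p.2 ^ 2))⁻¹ ≤
      9 * A * (L : ℝ) ^ 2 / (2 * π ^ 2) *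
        ((ε₂ + (4 + 8 / 3 * R.Gfr 1 * U ^ 2) * (2 * π / L)) / r + Real.sqrt (ε₂ + (4 + 8 / 3 * R.Gfr 1 * U ^ 2) * (2 * π / L))) *
        (β * Λ' / π * (3 + 2 * (4 + 8 / 3 * R.Gfr 1 * U ^ 2) * β / L) + 4 * (4 + 8 / 3 * R.Gfr 1 * U ^ 2) * β / L) := by
  classical
  have hπ := Real.pi_pos
  have hL : (0 : ℝ) < L := by exact_mod_cast Nat.pos_of_ne_zero (NeZero.ne L)
  have hGfr : ∀ j, 0 ≤ R.Gfr j := hR.wf.2.2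
  set G : ℝ := 4 + 8 / 3 * R.Gfr 1 * U ^ 2 with hG
  have hG0 : 0 ≤ G := by rw [hG]; nlinarith [hGfr 1, sq_nonneg U]
  set δ : ℝ := 2 * π / L with hδ
  have hδ0 : 0 < δ := by rw [hδ]; positivity
  set X : ℝ := (ε₂ + G * δ) / r + Real.sqrt (ε₂ + G * δ) with hX
  have hε₂0 : 0 < ε₂ := by linarith
  have hX0 : 0 ≤ X := by rw [hX]; positivity
  set ρ : FreqMomentum L M → ℝ := fun p => Real.sqrt (matsubaraFreq β M p.1 ^ 2 + nambuXiCT L μ K p.2 ^ 2) with hρ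
  set s := univ.filter (fun p : FreqMomentum L M => matsubaraFreq β M p.1 ^ 2 + nambuXiCT L μ K p.2 ^ 2 ≤ Λ' ^ 2 ∧ |nambuXiCT L μ K (p.2 - wt)| ≤ ε₂)
    with hs
  -- the floor `π/β ≤ ρ` and the top `ρ ≤ Λ′` on `s`
  have hlo : ∀ p ∈ s, π / β ≤ ρ p := fun p _ =>
    (pi_div_le_abs_matsubaraFreq hβ p.1).trans (Real.abs_le_sqrt (by nlinarith [sq_nonneg (nambuXiCT L μ K p.2)]))
  have hhi : ∀ p ∈ s, ρ p ≤ Λ' := fun p hp => by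
    have h1 := ((mem_filter.1 hp).2).1
    calc ρ p ≤ Real.sqrt (Λ' ^ 2) := Real.sqrt_le_sqrt h1
      _ = Λ' := Real.sqrt_sq hΛ'.le
  -- the right-hand side is nonnegative
  have hrhs : 0 ≤ 9 * A * (L : ℝ) ^ 2 / (2 * π ^ 2) * X * (β * Λ' / π * (3 + 2 * G * β / L) + 4 * G * β / L) := by positivity
  -- the empty case `Λ′ < π/β`
  by_cases hsmall : Λ' < π / β
  · have hs0 : s = ∅ := by
      refine eq_empty_of_forall_notMem fun p hp => ?_
      have := (hlo p hp).trans (hhi p hp)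
      linarith
    change ∑ p ∈ s, (ρ p)⁻¹ ≤ _
    rw [hs0, sum_empty]
    exact hrhs
  push Not at hsmall
  -- the number of layers: `2^I ≤ Λ′β/π < 2^{I+1}`
  set x : ℝ := Λ' * β / π with hx
  have hx1 : 1 ≤ x := by rw [hx, le_div_iff₀ hπ, one_mul]; rw [div_le_iff₀ hβ] at hsmall; linarith
  set Nn : ℕ := ⌊x⌋₊ with hNn
  have hNn1 : 1 ≤ Nn := by rw [hNn]; exact Nat.one_le_floor_iff _ |>.2 hx1
  set I : ℕ := Nat.log 2 Nn with hI
  have hIlo : (2 : ℝ) ^ I ≤ x := by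
    have h1 : (2 : ℕ) ^ I ≤ Nn := Nat.pow_log_le_self 2 (by omega)
    have h2 : ((2 : ℕ) ^ I : ℝ) ≤ (Nn : ℝ) := by exact_mod_cast h1
    push_cast at h2
    exact h2.trans (Nat.floor_le (by linarith))
  have hIhi : x ≤ (2 : ℝ) ^ (I + 1) := by
    have h1 : Nn < 2 ^ (I + 1) := Nat.lt_pow_succ_log_self one_lt_two Nn
    have h2 : (Nn : ℝ) + 1 ≤ ((2 : ℕ) ^ (I + 1) : ℕ) := by exact_mod_cast h1
    push_cast at h2
    exact (Nat.lt_floor_add_one x).le.trans h2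
  have hIm : Λ' ≤ 2 ^ (I + 1) * (π / β) := by
    have : x * (π / β) = Λ' := by rw [hx]; field_simp
    rw [← this]; exact mul_le_mul_of_nonneg_right hIhi (by positivity)
  -- step 1: the layer cake
  have step1 := sum_inv_le_dyadic s ρ (by positivity : 0 < π / β) I hIm hlo hhi
  -- step 2: each layer count
  have hcount : ∀ i ∈ range (I + 1), ((s.filter fun p => ρ p ≤ Λ' / 2 ^ i).card : ℝ) ≤
      (Λ' / 2 ^ i * β / π + 1) * (9 * A * (Λ' / 2 ^ i + G * δ) * X / δ ^ 2) := by
    intro i _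
    set a : ℝ := Λ' / 2 ^ i with ha
    have ha0 : 0 < a := by rw [ha]; positivity
    have haΛ : a ≤ Λ' := by
      rw [ha, div_le_iff₀ (by positivity)]
      have : (1 : ℝ) ≤ 2 ^ i := one_le_pow₀ (by norm_num)
      nlinarith
    -- (i) into the disc filter
    have hsub : (s.filter fun p => ρ p ≤ a) ⊆ univ.filter (fun p : FreqMomentum L M =>
        matsubaraFreq β M p.1 ^ 2 + nambuXiCT L μ K p.2 ^ 2 ≤ a ^ 2 ∧ |nambuXiCT L μ K (p.2 - wt)| ≤ ε₂) := by
      intro p hp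
      obtain ⟨hps, hpa⟩ := mem_filter.1 hp
      obtain ⟨-, hQ⟩ := (mem_filter.1 hps).2
      refine mem_filter.2 ⟨Finset.mem_univ _, ?_, hQ⟩
      have h0 : 0 ≤ matsubaraFreq β M p.1 ^ 2 + nambuXiCT L μ K p.2 ^ 2 := by positivity
      have := Real.sq_sqrt h0
      have hρ0 : 0 ≤ ρ p := Real.sqrt_nonneg _
      nlinarith
    have c1 : ((s.filter fun p => ρ p ≤ a).card : ℝ) ≤ ((univ.filter (fun p : FreqMomentum L M =>
        matsubaraFreq β M p.1 ^ 2 + nambuXiCT L μ K p.2 ^ 2 ≤ a ^ 2 ∧ |nambuXiCT L μ K (p.2 - wt)| ≤ ε₂)).card : ℝ) :=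
      Nat.cast_le.2 (Finset.card_le_card hsub)
    -- (ii) disc count = frequencies × momenta
    have c2 := card_disc_filter_le_sharp (M := M) hβ μ K ha0.le (fun k : TorusSite 2 L => |nambuXiCT L μ K (k - wt)| ≤ ε₂)
    -- (iii) the momentum count by the lattice two-shell count at `ε₁ = a` itself (closed shell)
    have c3 := card_twoShell_mul_sq_le_closed h hA hR hU hUu hμ hK ha0 (by linarith : a < ε₂) h2 wt hr hrw
    have c3' : ((univ.filter fun k : TorusSite 2 L => |nambuXiCT L μ K k| ≤ a ∧ |nambuXiCT L μ K (k - wt)| ≤ ε₂).card : ℝ) ≤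
        9 * A * (a + G * δ) * X / δ ^ 2 := by
      rw [le_div_iff₀ (by positivity)]
      exact c3.trans (le_of_eq (by rw [hX, hG, hδ]; ring))
    calc ((s.filter fun p => ρ p ≤ a).card : ℝ) ≤ _ := c1
      _ ≤ (a * β / π + 1) * _ := c2
      _ ≤ (a * β / π + 1) * (9 * A * (a + G * δ) * X / δ ^ 2) := mul_le_mul_of_nonneg_left c3' (by positivity)
  -- step 3: sum the layers
  have step3 : ∑ i ∈ range (I + 1), (2 : ℝ) ^ (i + 1) / Λ' * ((s.filter fun p => ρ p ≤ Λ' / 2 ^ i).card : ℝ) ≤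
      ∑ i ∈ range (I + 1), 18 * A * X / δ ^ 2 * (β / π * (Λ' / 2 ^ i) + (G * δ * β / π + 1) + G * δ * ((2 : ℝ) ^ i / Λ')) := by
    refine sum_le_sum fun i hi => ?_
    have hpos : 0 ≤ (2 : ℝ) ^ (i + 1) / Λ' := by positivity
    refine (mul_le_mul_of_nonneg_left (hcount i hi) hpos).trans (le_of_eq ?_)
    have h2i : (2 : ℝ) ^ i ≠ 0 := by positivity
    field_simp
    ring
  have hI1 : ((I : ℝ) + 1) ≤ x := by
    have h1 : (I : ℝ) + 1 ≤ (2 : ℝ) ^ I := by exact_mod_cast Nat.lt_two_pow_self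
    exact h1.trans hIlo
  have h2I : (2 : ℝ) ^ (I + 1) / Λ' ≤ 2 * β / π := by
    rw [div_le_iff₀ hΛ', pow_succ]
    have : (2 : ℝ) ^ I * 2 ≤ x * 2 := by linarith [hIlo]
    rw [hx] at this
    calc (2 : ℝ) ^ I * 2 ≤ Λ' * β / π * 2 := this
      _ = 2 * β / π * Λ' := by ring
  have step4 := sum_layers_le_sharp hA hX0 hδ0 hβ hΛ' hG0 I hI1 h2I
  have final := layers_closed_form_sharp (A := A) (X := X) (β := β) (Λ' := Λ') (G := G) hL
  rw [hx] at step4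
  rw [← hδ] at final
  exact step1.trans (step3.trans (step4.trans final.le))

/-- **The package instance of the sharp weighted mass** (`A = klTS`, `u = klTSU`). -/
theorem twoShell_weighted_sum_le_sharp_klTS {R : RenConsts} (hR : R.WF2) {U : ℝ} (hU : 0 < U) (hUu : U ≤ klTSU R) {μ : ℝ} (hμ : μ ∈ klWindowC)
    {N : ℕ} {K : TrigPolyC4v} (hK : FrameOK R U N μ K) {L M : ℕ} [NeZero L] [NeZero M] {β : ℝ} (hβ : 0 < β) {Λ' ε₂ : ℝ} (hΛ' : 0 < Λ')
    (h2Λ : 2 * Λ' ≤ ε₂) (h2 : ε₂ + (4 + 8 / 3 * R.Gfr 1 * U ^ 2) * (2 * π / L) ≤ klE0) (wt : TorusSite 2 L) {r : ℝ} (hr : 0 < r)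
    (hrw : r ≤ klTorusNorm L wt) :
    ∑ p ∈ univ.filter (fun p : FreqMomentum L M => matsubaraFreq β M p.1 ^ 2 + nambuXiCT L μ K p.2 ^ 2 ≤ Λ' ^ 2 ∧ |nambuXiCT L μ K (p.2 - wt)| ≤ ε₂),
        (Real.sqrt (matsubaraFreq β M p.1 ^ 2 + nambuXiCT L μ K p.2 ^ 2))⁻¹ ≤
      9 * klTS * (L : ℝ) ^ 2 / (2 * π ^ 2) *
        ((ε₂ + (4 + 8 / 3 * R.Gfr 1 * U ^ 2) * (2 * π / L)) / r + Real.sqrt (ε₂ + (4 + 8 / 3 * R.Gfr 1 * U ^ 2) * (2 * π / L))) *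
        (β * Λ' / π * (3 + 2 * (4 + 8 / 3 * R.Gfr 1 * U ^ 2) * β / L) + 4 * (4 + 8 / 3 * R.Gfr 1 * U ^ 2) * β / L) :=
  twoShell_weighted_sum_le_sharp twoShellFrameAreaAt_klTS klTS_nonneg hR hU hUu hμ hK hβ hΛ' h2Λ h2 wt hr hrw

end Summit.HubbardSuperconductivity.HubbardSuperconductivity.Theorems.EngineV8

end
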